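import Summits.BirchSwinnertonDyer.BirchSwinnertonDyer.Theorems.SignedLowerHalvesSmallImageLowerHalfBothSignsLambdaLowerThreeNsThetaPartnerTraceCongruence
import Summits.BirchSwinnertonDyer.BirchSwinnertonDyer.Theorems.SignedLowerHalvesSmallImageLowerHalfBothSignsLambdaLowerThreeNsThetaPartnerPlaces
import Literature.NumberTheory.GaloisRepresentations.FrobeniusValuesInTwoCharacters
import Literature.NumberTheory.GaloisRepresentations.SerreCartanNormalizerGL2Fp
import Literature.NumberTheory.EllipticCurves.CMNewformOfHeckeCharacterProofs
import Literature.NumberTheory.EllipticCurves.GrossPointsCount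
import Literature.NumberTheory.EllipticCurves.NewformPadicIntegralModel
import Literature.NumberTheory.GaloisRepresentations.GaloisRep
import HarnessLib

/-!
# Route `SignedLowerHalves`, crux L `SmallImageLowerHalfBothSigns` (item stmt-BirchSwinnertonDyer-23599), line `rtt_w3` v9 —
# conjunct E1 of `stub_charRoad_ns`, brick E1-a: THE RESIDUAL CHARACTER OF `θ = ψ_𝔭` IS ONE OF THE TWO EIGENCHARACTERS OF `ρ̄_{W,p}|_{Γ_K}`

Width seat `bsd-line-slh-p3-w3` g16 under LEAD `cruxlead-stmt-BirchSwinnertonDyer-23599` g6 (GO 2026-08-30); helper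
`--supports stmt-BirchSwinnertonDyer-23599`; THEOREMS ONLY, no `sorry`; closes nothing; BSD / crux L / E1 / COUNT are NOT proved by this.

SETTING (the registered prefix binders of `stub_charRoad_ns`): `W/ℚ`, `p` odd, the Cartan frame `Φ : Aut(W[p]) ≃ GL₂(𝔽_p)`,
`k ⊆ M₂(𝔽_p)` a field with `[k:𝔽_p] = 2` normalised by the image of `ρ̄ = ρ̄_{W,p}` (`hGN`), the quadratic field `K` with
`ρ̄(Γ_K) ⊆ kˣ` (`hKU`), the Grössencharakter `ψ mod 𝔪` of `K` with the CENTRALITY clause `hneb` (`ψ((n)) = (d_K/n)·n`) and the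
CONGRUENCE clause `htrace` (`‖e⁻¹(∑_{N w = ℓ} ψ w) − a_ℓ(W)‖ < 1` at good `ℓ ≠ p`), and the integral character
`θ : Γ_K → GL₁(𝒪_S)` PINNED to `ψ` (`hθ`: at `w ∤ p𝔪`, `θ` unramified with arithmetic-Frobenius polynomial `X − C(e⁻¹ψ(w))`).
Brick B3′ (`SmallImageRttShapiro.exists_equiv_coind_of_smallImageDatum`, p757129) hands the EIGENCHARACTER
`χ : U → k'ˣ` of `ρ̄ ⊗ k'|_U`, `U = ρ̄⁻¹(kˣ) ⊇ res(Γ_K)`, over any field `k' ⊇ 𝔽_p` holding a root `lam` of the minimal polynomial of a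
generator `y₀` of `k`: `χ(u) = a + b·lam` when `Φρ̄(u) = a + b·y₀`; and an element `c` with `Φρ̄(c) ∉ kˣ`.

THEOREM (sequel file `…E1ResidualCharacterGlobal`) ★ `residualChar_eq_or_eq_conj`: for every ring map `r : 𝒪_S → k'` killing the topologically nilpotent elements (`‖x‖ < 1 ⇒ r x = 0`,
e.g. the residue map followed by an embedding), EITHER `r(θ(τ)₀₀) = χ(res τ)` for all `τ ∈ Γ_K`, OR `r(θ(τ)₀₀) = χ(c·res τ·c⁻¹)` for all
`τ ∈ Γ_K` — i.e. **`θ̄ = χ` or `θ̄ = χᶜ`** (E1-a of the LEAD's brick cut, BRIEF-v8 §7; consumer: the Shapiro transfer E1-b / COUNT).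

THIS FILE proves the POINTWISE half ★ `residualChar_frob_eq_or_eq` (the global statement follows in the sequel by density): at a place `w` of `K` of prime norm `ℓ` off a finite
bad set, with `Frob ∈ Γ_K` arithmetic at `w` and `σ = res Frob`: the places over `ℓ` are `w₀ ≠ w₁` (`exists_places_split_of_mem_range`),
`x_i ∈ 𝒪_S` the roots of the pinned polynomials (`x_i = e⁻¹ψ(w_i)` in `ℚ̄_p`), `x₀ + x₁ ≡ a_ℓ` (`htrace`), `x₀x₁ = ψ((ℓ)) = (d_K/ℓ)·ℓ = ℓ`
(`idealPow_span_natGenerator_of_pair`, centrality, `(d_K/ℓ) = 1` as `ℓ` splits); on the other side `y₀ = Φρ̄(σ)`, `y₁ = Φρ̄(cσc⁻¹)` satisfy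
`y₀ + y₁ = a_ℓ·1` (`frob_add_conj_eq_frobeniusTrace_smul_one_of_mem`) and `y₀y₁ = det(y₀)·1 = ℓ·1` (Cayley–Hamilton, `det_frob_eq`),
whence `χ(σ) + χ(cσc⁻¹) = a_ℓ`, `χ(σ)χ(cσc⁻¹) = ℓ` in `k'`; so `r(x_i)` and `χ(σ), χ(cσc⁻¹)` are the two roots of THE SAME quadratic
over the field `k'`, and `θ̄(Frob) = r(x_w) ∈ {χ(σ), χ(cσc⁻¹)}` (the global statement: density one of the split primes, sequel file).

References: [Serre1972] §2.2, §4.2 c); [SerreAbelianLadic1968] Ch. I §2.3; [Ribet1977Nebentypus] §3; [NeukirchANT1999] VII §13; [Rubin1991] §4.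
-/

set_option autoImplicit false
-- D-0017: single-problem summit, the namespace repeats the problem name by design.
set_option linter.dupNamespace false
noncomputable section

open scoped NumberField MatrixGroups Classical
open NumberField IsDedekindDomain Field Polynomial Matrix WeierstrassCurve Rat.HeightOneSpectrum
  Literature.NumberTheory.GaloisRepresentations Literature.NumberTheory.EllipticCurves Literature.NumberTheory.LFunctions
  Literature.NumberTheory.GaloisRepresentations.Serre1972
  Summit.BirchSwinnertonDyer.BirchSwinnertonDyer.Theorems.SmallImageLambdaLowerThreeNsThetaPartner

namespace Summit.BirchSwinnertonDyer.BirchSwinnertonDyer.Theorems.SmallImageRttCharRoad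

/-! ## §1 Small algebra -/

section Algebra
/-- In a field, an element whose sum and product with a companion are those of a pair `{α, β}` is `α` or `β`
(the two root multisets of one quadratic). [folklore] -/
theorem eq_or_eq_of_add_eq_of_mul_eq {F : Type*} [Field F] {x y α β : F} (hs : x + y = α + β) (hp : x * y = α * β) :
    x = α ∨ x = β := by
  have h : (x - α) * (x - β) = 0 := by
    have hy : y = α + β - x := by rw [← hs]; ring
    rw [hy] at hp
    linear_combination -hp
  exact (mul_eq_zero.mp h).imp sub_eq_zero.mp sub_eq_zero.mp

/-- Coordinates on `{1, y₀}` are unique when `y₀` is not a scalar. [folklore] -/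
theorem smul_one_add_smul_inj {F : Type*} [Field F] {y₀ : Matrix (Fin 2) (Fin 2) F} (hys : ∀ c : F, y₀ ≠ c • 1)
    {a b a' b' : F} (h : a • (1 : Matrix (Fin 2) (Fin 2) F) + b • y₀ = a' • 1 + b' • y₀) : a = a' ∧ b = b' := by
  have hb : b = b' := by
    by_contra hb
    have hne : b - b' ≠ 0 := sub_ne_zero.mpr hb
    apply hys ((a' - a) / (b - b'))
    have h1 : (b - b') • y₀ = (a' - a) • (1 : Matrix (Fin 2) (Fin 2) F) := by
      rw [sub_smul, sub_smul]
      exact sub_eq_sub_iff_add_eq_add.mpr (by rw [add_comm]; exact h)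
    calc y₀ = (b - b')⁻¹ • ((b - b') • y₀) := by rw [smul_smul, inv_mul_cancel₀ hne, one_smul]
      _ = ((a' - a) / (b - b')) • 1 := by rw [h1, smul_smul, div_eq_inv_mul]
  refine ⟨?_, hb⟩
  rw [hb] at h
  have h2 : a • (1 : Matrix (Fin 2) (Fin 2) F) = a' • 1 := add_right_cancel h
  have h3 := congrFun (congrFun h2 0) 0
  simpa using h3

end Algebra

/-! ## §2 The value of the pinned character at a place: the root of `X − C(e⁻¹ψ w)` -/

section Pin

variable {K : Type} [Field K] [NumberField K] {p : ℕ} [Fact p.Prime] {S : Set (PadicAlgCl p)}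

omit [NumberField K] in
/-- From the pinning `P.map 𝒪.subtype = X − C a`, `θ.HasFrobCharpolyAt w P`: at every arithmetic Frobenius `F` at a prime above `w`,
the entry `θ(F)₀₀ ∈ 𝒪_S` has image `a` in `ℚ̄_p` (rank one: the characteristic polynomial is `X − C(θ(F)₀₀)`).
[cite: SerreAbelianLadic1968, Ch. I §2.3] -/
theorem coe_apply_eq_of_hasFrobCharpolyAt (θ : FramedGaloisRep K (padicCoeffIntegers S) 1) {w : HeightOneSpectrum (𝓞 K)}
    {P : Polynomial (padicCoeffIntegers S)} {a : PadicAlgCl p}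
    (hP : P.map (padicCoeffIntegers S).subtype = X - C a) (hθ : θ.HasFrobCharpolyAt w P)
    {𝔔 : Ideal (absIntegers (𝓞 K) K)} (h𝔔 : 𝔔 ∈ w.primesAbove) {F : absoluteGaloisGroup K} (hF : IsArithFrobAt (𝓞 K) F 𝔔) :
    ((((θ F : GL (Fin 1) (padicCoeffIntegers S)) : Matrix (Fin 1) (Fin 1) (padicCoeffIntegers S)) 0 0 :
        padicCoeffIntegers S) : PadicAlgCl p) = a := by
  have hc := hθ 𝔔 h𝔔 F hF
  -- the trace of a `1 × 1` matrix is its entry and minus the constant coefficient of its characteristic polynomial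
  have htr : ((θ F : GL (Fin 1) (padicCoeffIntegers S)) : Matrix (Fin 1) (Fin 1) (padicCoeffIntegers S)) 0 0 =
      -(P.coeff 0) := by
    have h1 := Matrix.trace_eq_neg_charpoly_coeff
      ((θ F : GL (Fin 1) (padicCoeffIntegers S)) : Matrix (Fin 1) (Fin 1) (padicCoeffIntegers S))
    rw [Matrix.trace_fin_one, Fintype.card_fin] at h1
    change _ = -((FramedRep.charpoly θ F).coeff (1 - 1)) at h1
    rw [hc] at h1
    exact h1
  have hcoeff : ((P.coeff 0 : padicCoeffIntegers S) : PadicAlgCl p) = -a := by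
    have h := congrArg (fun Q : Polynomial (PadicAlgCl p) => Q.coeff 0) hP
    simp only [Polynomial.coeff_map, Polynomial.coeff_sub, Polynomial.coeff_X_zero, Polynomial.coeff_C_zero,
      zero_sub] at h
    exact h
  rw [htr]
  push_cast
  rw [hcoeff, neg_neg]

end Pin

/-! ## §3 The pointwise alternative at the Frobenii of the split primes -/

section Pointwise

variable (W : WeierstrassCurve ℚ) [W.IsElliptic] [W.IsGloballyMinimal] (p : ℕ) [Fact p.Prime]
  (Φ : Multiplicative (AddAut (geomTorsion W p)) ≃* GL (Fin 2) (ZMod p))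
  {k : Subalgebra (ZMod p) (Matrix (Fin 2) (Fin 2) (ZMod p))}
  (K : Type) [Field K] [NumberField K]

/-- ★ **Pointwise alternative at a split prime.** In the setting of the module docstring, at a place `w` of `K` of prime absolute
norm `ℓ` with `ℓ ≠ 2`, `ℓ ≠ p`, `ℓ ∤ d_K·N(𝔪)` and `W` good at `ℓ`, for every arithmetic Frobenius `F ∈ Γ_K` at a prime above `w`:
`r(θ(F)₀₀) = χ(res F)` or `r(θ(F)₀₀) = χ(c·res F·c⁻¹)` — both sides are roots of `X² − a_ℓ X + ℓ` in `k'`.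
[cite: Serre1972, §2.2, §4.2 c)] [cite: Ribet1977Nebentypus, §3 (LNM 601, p. 34)] [cite: SerreAbelianLadic1968, Ch. I §2.3] -/
theorem residualChar_frob_eq_or_eq (hk : IsField k) (h2k : Module.finrank (ZMod p) k = 2)
    (e₀ : geomTorsion W p ≃+ (Fin 2 → ZMod p))
    (he₀ : ∀ (g : Multiplicative (AddAut (geomTorsion W p))) (x : geomTorsion W p),
      e₀ (Multiplicative.toAdd g x) = ((Φ g : GL (Fin 2) (ZMod p)) : Matrix (Fin 2) (Fin 2) (ZMod p)) *ᵥ e₀ x)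
    (htr : letI : Module (ZMod p) (geomTorsion W p) := AddSubgroup.torsionBy.zmodModule
      ∀ g : Multiplicative (AddAut (geomTorsion W p)),
        Matrix.trace ((Φ g : GL (Fin 2) (ZMod p)) : Matrix (Fin 2) (Fin 2) (ZMod p)) =
          LinearMap.trace (ZMod p) (geomTorsion W p) ((Multiplicative.toAdd g).toAddMonoidHom.toZModLinearMap p))
    (hGN : (galoisRepTorsion W p).range.map Φ.toMonoidHom ≤
      Subgroup.normalizer (Serre1972.unitGroup k : Set (GL (Fin 2) (ZMod p))))
    (hK2 : Module.finrank ℚ K = 2)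
    (hKU : ∀ τ : absoluteGaloisGroup K, Φ (galoisRepTorsion W p (absGaloisRestrict ℚ K τ)) ∈ Serre1972.unitGroup k)
    (𝔪 : Ideal (𝓞 K)) (ψ : HeightOneSpectrum (𝓞 K) → ℂ) (e : PadicAlgCl p ≃+* ℂ)
    (hneb : ∀ n : ℕ, Odd n → n.Coprime ((NumberField.discr K).natAbs * Ideal.absNorm 𝔪) →
      idealPow K ψ (Ideal.span {(n : 𝓞 K)}) = (jacobiSym (NumberField.discr K) n : ℂ) * (n : ℂ) ^ (2 - 1))
    (htrace : ∀ (ℓ : ℕ) [Fact ℓ.Prime], ℓ ≠ p → W.HasGoodReductionAtPrime ℓ →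
      ‖e.symm (∑ᶠ (w : HeightOneSpectrum (𝓞 K)) (_ : Ideal.absNorm w.asIdeal = ℓ), ψ w) -
        (W.frobeniusTrace ℓ : PadicAlgCl p)‖ < 1)
    {S : Set (PadicAlgCl p)} (θ : FramedGaloisRep K (padicCoeffIntegers S) 1)
    (hθ : ∀ w : HeightOneSpectrum (𝓞 K), (p : 𝓞 K) ∉ w.asIdeal → ¬ 𝔪 ≤ w.asIdeal →
      θ.IsUnramifiedAt w ∧ ∃ P : Polynomial (padicCoeffIntegers S),
        P.map (padicCoeffIntegers S).subtype = X - C (e.symm (ψ w)) ∧ θ.HasFrobCharpolyAt w P)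
    {k' : Type} [Field k'] [Algebra (ZMod p) k'] (r : padicCoeffIntegers S →+* k')
    (hr : ∀ x : padicCoeffIntegers S, ‖(x : PadicAlgCl p)‖ < 1 → r x = 0)
    {y₀ : Matrix (Fin 2) (Fin 2) (ZMod p)} (hy₀ : y₀ ∈ k) (hys : ∀ c : ZMod p, y₀ ≠ c • 1) (lam : k')
    (χ : (Serre1972.unitGroup k).comap (Φ.toMonoidHom.comp (galoisRepTorsion W p)) →* k'ˣ)
    (hχ : ∀ (u : (Serre1972.unitGroup k).comap (Φ.toMonoidHom.comp (galoisRepTorsion W p))) (a b : ZMod p),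
      ((Φ (galoisRepTorsion W p (u : absoluteGaloisGroup ℚ)) : GL (Fin 2) (ZMod p)) : Matrix (Fin 2) (Fin 2) (ZMod p)) =
          a • (1 : Matrix (Fin 2) (Fin 2) (ZMod p)) + b • y₀ →
        ((χ u : k'ˣ) : k') = algebraMap (ZMod p) k' a + algebraMap (ZMod p) k' b * lam)
    (c : absoluteGaloisGroup ℚ) (hc : Φ (galoisRepTorsion W p c) ∉ Serre1972.unitGroup k)
    {w : HeightOneSpectrum (𝓞 K)} {ℓ : ℕ} [Fact ℓ.Prime] (hwℓ : Ideal.absNorm w.asIdeal = ℓ) (hℓ2 : ℓ ≠ 2) (hℓp : ℓ ≠ p)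
    (hℓD : ¬ (ℓ : ℤ) ∣ NumberField.discr K) (hℓ𝔪 : ¬ ℓ ∣ Ideal.absNorm 𝔪) (hgood : W.HasGoodReductionAtPrime ℓ)
    {𝔔 : Ideal (absIntegers (𝓞 K) K)} (h𝔔 : 𝔔 ∈ w.primesAbove) {F : absoluteGaloisGroup K} (hF : IsArithFrobAt (𝓞 K) F 𝔔) :
    r ((((θ F : GL (Fin 1) (padicCoeffIntegers S)) : Matrix (Fin 1) (Fin 1) (padicCoeffIntegers S)) 0 0)) =
        ((χ ⟨absGaloisRestrict ℚ K F, hKU F⟩ : k'ˣ) : k') ∨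
      r ((((θ F : GL (Fin 1) (padicCoeffIntegers S)) : Matrix (Fin 1) (Fin 1) (padicCoeffIntegers S)) 0 0)) =
        ((χ ⟨c * absGaloisRestrict ℚ K F * c⁻¹, conj_mem_of_mem W p Φ hGN c (hKU F)⟩ : k'ˣ) : k') := by
  have hℓ : ℓ.Prime := Fact.out
  haveI : FiniteDimensional ℚ K := Module.finite_of_finrank_eq_succ hK2
  haveI : Algebra.IsQuadraticExtension ℚ K := { finrank_eq_two' := hK2 }
  haveI : IsGalois ℚ K := inferInstance
  -- the subgroup `H = res(Γ_K) = U`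
  set H : Subgroup (absoluteGaloisGroup ℚ) := (absGaloisRestrict ℚ K).range with hHdef
  have hHi : H.index = Module.finrank ℚ K := index_range_absGaloisRestrict_eq_finrank ℚ K
  have hHn : H.Normal := Subgroup.normal_of_index_eq_two (hHi.trans hK2)
  have hl : (Module.finrank ℚ K).Prime := by rw [hK2]; exact Nat.prime_two
  have hcH : c ∉ H := by
    rintro ⟨τ, rfl⟩
    exact hc (hKU τ)
  -- the place `v` of `ℚ` below `w`, the prime `𝔓₀` below `𝔔`, and the Frobenius `σ = res F` there
  set v : HeightOneSpectrum (𝓞 ℚ) := (primesEquiv).symm ⟨ℓ, hℓ⟩ with hvdef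
  have hv : (primesEquiv v : ℕ) = ℓ := by rw [hvdef, Equiv.apply_symm_apply]
  have hwv : ∀ w' : HeightOneSpectrum (𝓞 K), w'.under (𝓞 ℚ) = v ↔ (ℓ : 𝓞 K) ∈ w'.asIdeal := fun w' => by
    rw [under_eq_iff_natCast_primesEquiv_mem, hv]
  have hwv₀ : w.under (𝓞 ℚ) = v := (hwv w).mpr (natCast_mem_of_absNorm_eq' hwℓ)
  have hwv₀' : w.asIdeal.under (𝓞 ℚ) = v.asIdeal := congrArg HeightOneSpectrum.asIdeal hwv₀
  have hf1 : w.asIdeal.inertiaDeg (𝓞 ℚ) = 1 := by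
    have h := absNorm_eq_pow_inertiaDeg_of_under_eq hv hwv₀
    rw [hwℓ] at h
    have h' : ℓ ^ 1 = ℓ ^ w.asIdeal.inertiaDeg (𝓞 ℚ) := by rw [pow_one]; exact h
    exact (Nat.pow_right_injective hℓ.two_le h').symm
  set 𝔓₀ : Ideal (absIntegers (𝓞 ℚ) ℚ) := 𝔔.comap (absIntegersMap ℚ K) with h𝔓₀def
  have h𝔓₀ : 𝔓₀ ∈ v.primesAbove := comap_absIntegersMap_mem_primesAbove hwv₀' h𝔔
  set σ : absoluteGaloisGroup ℚ := absGaloisRestrict ℚ K F with hσdef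
  have hσF : IsArithFrobAt (𝓞 ℚ) σ 𝔓₀ := isArithFrobAt_absGaloisRestrict_of_inertiaDeg_eq_one hwv₀' h𝔔 hF hf1
  have hσH : σ ∈ H := ⟨F, rfl⟩
  have hunr : Algebra.IsUnramifiedIn (𝓞 K) v.asIdeal := isUnramifiedIn_asIdeal_of_not_dvd_discr (K := K) hv hℓD
  -- the two places above `ℓ`
  obtain ⟨P, 𝔔', τ, hP, hf1', hcov, hinj⟩ :=
    exists_places_split_of_mem_range (F := ℚ) (M := K) hl hHn hHi hcH hunr h𝔓₀ hσF hσH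
  rw [hK2] at hcov hinj
  have h01 : P 0 ≠ P 1 := fun h => absurd (hinj 0 (by norm_num) 1 (by norm_num) h) (by norm_num)
  have hSv : {w' : HeightOneSpectrum (𝓞 K) | w'.asIdeal.under (𝓞 ℚ) = v.asIdeal} = {P 0, P 1} := by
    ext w'
    simp only [Set.mem_setOf_eq, Set.mem_insert_iff, Set.mem_singleton_iff]
    constructor
    · intro hw'
      have hw'' : w'.under (𝓞 ℚ) = v := HeightOneSpectrum.ext (by rw [HeightOneSpectrum.under_asIdeal]; exact hw')
      obtain ⟨i, hi, hiw⟩ := hcov w' hw''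
      interval_cases i
      · exact Or.inl hiw.symm
      · exact Or.inr hiw.symm
    · rintro (rfl | rfl)
      · exact congrArg HeightOneSpectrum.asIdeal (hP 0).1
      · exact congrArg HeightOneSpectrum.asIdeal (hP 1).1
  have hSℓ : {w' : HeightOneSpectrum (𝓞 K) | Ideal.absNorm w'.asIdeal = ℓ} = {P 0, P 1} := by
    ext w'
    simp only [Set.mem_setOf_eq, Set.mem_insert_iff, Set.mem_singleton_iff]
    constructor
    · intro hw'
      obtain ⟨i, hi, hiw⟩ := hcov w' ((hwv w').mpr (natCast_mem_of_absNorm_eq' hw'))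
      interval_cases i
      · exact Or.inl hiw.symm
      · exact Or.inr hiw.symm
    · rintro (rfl | rfl)
      · rw [absNorm_eq_pow_inertiaDeg_of_under_eq hv (hP 0).1, hf1' _ (hP 0).1, pow_one]
      · rw [absNorm_eq_pow_inertiaDeg_of_under_eq hv (hP 1).1, hf1' _ (hP 1).1, pow_one]
  -- `p ∉ P i`, `𝔪 ≰ P i`
  have hPp : ∀ i, (p : 𝓞 K) ∉ (P i).asIdeal := by
    intro i hpi
    have hℓi : (ℓ : 𝓞 K) ∈ (P i).asIdeal := (hwv _).mp (hP i).1
    have hcop : IsCoprime (((ℓ : ℤ) : 𝓞 K)) (((p : ℤ) : 𝓞 K)) :=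
      (Nat.isCoprime_iff_coprime.mpr ((Nat.coprime_primes hℓ Fact.out).mpr hℓp)).map (Int.castRingHom (𝓞 K))
    obtain ⟨a, b, hab⟩ := hcop
    apply (P i).isPrime.ne_top
    rw [Ideal.eq_top_iff_one, ← hab]
    push_cast
    exact Ideal.add_mem _ (Ideal.mul_mem_left _ _ hℓi) (Ideal.mul_mem_left _ _ hpi)
  have hPℓ : ∀ i : Fin 2, Ideal.absNorm (P i).asIdeal = ℓ := by
    intro i
    have hi : P i ∈ ({P 0, P 1} : Set (HeightOneSpectrum (𝓞 K))) := by
      fin_cases i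
      · exact Set.mem_insert _ _
      · exact Set.mem_insert_of_mem _ rfl
    rw [← hSℓ] at hi
    exact hi
  have hP𝔪 : ∀ i : Fin 2, ¬ 𝔪 ≤ (P i).asIdeal := fun i hle => hℓ𝔪 (by
    have h := Ideal.absNorm_dvd_absNorm_of_le hle
    rwa [hPℓ i] at h)
  -- the pinned values `x₀, x₁ ∈ 𝒪_S` at `P 0`, `P 1` (`x_i = e⁻¹ ψ(P i)` in `ℚ̄_p`)
  obtain ⟨-, Q₀, hQ₀, hθ₀⟩ := hθ (P 0) (hPp 0) (hP𝔪 0)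
  obtain ⟨-, Q₁, hQ₁, hθ₁⟩ := hθ (P 1) (hPp 1) (hP𝔪 1)
  set x₀ : padicCoeffIntegers S :=
    ((θ (τ 0) : GL (Fin 1) (padicCoeffIntegers S)) : Matrix (Fin 1) (Fin 1) (padicCoeffIntegers S)) 0 0 with hx₀def
  set x₁ : padicCoeffIntegers S :=
    ((θ (τ 1) : GL (Fin 1) (padicCoeffIntegers S)) : Matrix (Fin 1) (Fin 1) (padicCoeffIntegers S)) 0 0 with hx₁def
  have hx₀ : (x₀ : PadicAlgCl p) = e.symm (ψ (P 0)) :=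
    coe_apply_eq_of_hasFrobCharpolyAt θ hQ₀ hθ₀ (hP 0).2.1 (hP 0).2.2.2.1
  have hx₁ : (x₁ : PadicAlgCl p) = e.symm (ψ (P 1)) :=
    coe_apply_eq_of_hasFrobCharpolyAt θ hQ₁ hθ₁ (hP 1).2.1 (hP 1).2.2.2.1
  -- `θ(F)₀₀` is one of them
  have hxF : ((((θ F : GL (Fin 1) (padicCoeffIntegers S)) : Matrix (Fin 1) (Fin 1) (padicCoeffIntegers S)) 0 0) = x₀) ∨
      ((((θ F : GL (Fin 1) (padicCoeffIntegers S)) : Matrix (Fin 1) (Fin 1) (padicCoeffIntegers S)) 0 0) = x₁) := by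
    obtain ⟨i, hi, hiw⟩ := hcov w hwv₀
    interval_cases i
    · left
      subst hiw
      exact Subtype.ext ((coe_apply_eq_of_hasFrobCharpolyAt θ hQ₀ hθ₀ h𝔔 hF).trans hx₀.symm)
    · right
      subst hiw
      exact Subtype.ext ((coe_apply_eq_of_hasFrobCharpolyAt θ hQ₁ hθ₁ h𝔔 hF).trans hx₁.symm)
  -- SUM: `r x₀ + r x₁ = a_ℓ` (congruence clause)
  have hsumS : r x₀ + r x₁ = ((W.frobeniusTrace ℓ : ℤ) : k') := by
    have hfin : (∑ᶠ (w' : HeightOneSpectrum (𝓞 K)) (_ : Ideal.absNorm w'.asIdeal = ℓ), ψ w') = ψ (P 0) + ψ (P 1) := by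
      have h1 : (∑ᶠ (w' : HeightOneSpectrum (𝓞 K)) (_ : Ideal.absNorm w'.asIdeal = ℓ), ψ w') =
          ∑ᶠ w' ∈ ({P 0, P 1} : Set (HeightOneSpectrum (𝓞 K))), ψ w' := by rw [← hSℓ]; rfl
      rw [h1, finsum_mem_pair h01]
    have hlt := htrace ℓ hℓp hgood
    rw [hfin, map_add, ← hx₀, ← hx₁] at hlt
    have hz : r (x₀ + x₁ - ((W.frobeniusTrace ℓ : ℤ) : padicCoeffIntegers S)) = 0 := by
      apply hr
      push_cast
      exact hlt
    rw [map_sub, map_add, map_intCast, sub_eq_zero] at hz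
    exact hz
  -- PRODUCT: `r x₀ * r x₁ = ℓ` (centrality + `ℓ` splits)
  have hℓcop : ℓ.Coprime ((NumberField.discr K).natAbs * Ideal.absNorm 𝔪) := by
    refine Nat.Coprime.mul_right ?_ ((Nat.Prime.coprime_iff_not_dvd hℓ).mpr hℓ𝔪)
    exact (Nat.Prime.coprime_iff_not_dvd hℓ).mpr fun h => hℓD (Int.natCast_dvd.mpr h)
  have hjac : jacobiSym (NumberField.discr K) ℓ = 1 := by
    -- `ℓ` splits: the primes over `(ℓ) ⊂ ℤ` are `P 0 ≠ P 1`
    refine (Literature.NumberTheory.QuadraticFields.Quadratic.ncard_primesOver_eq_two_iff_jacobiSym hK2 hℓ hℓ2).mp ?_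
    have hset : (Ideal.span {(ℓ : ℤ)}).primesOver (𝓞 K) = {(P 0).asIdeal, (P 1).asIdeal} := by
      ext Q
      simp only [Set.mem_insert_iff, Set.mem_singleton_iff]
      constructor
      · rintro ⟨hQ, hover⟩
        haveI := hQ
        have hℓQ : (ℓ : 𝓞 K) ∈ Q := (liesOver_span_iff_natCast_mem hℓ Q).mp hover
        have hQ0 : Q ≠ ⊥ := fun h => by
          rw [h, Ideal.mem_bot] at hℓQ
          exact hℓ.ne_zero (by exact_mod_cast hℓQ)
        set w' : HeightOneSpectrum (𝓞 K) := ⟨Q, hQ, hQ0⟩ with hw'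
        obtain ⟨i, hi, hiw⟩ := hcov w' ((hwv w').mpr hℓQ)
        interval_cases i
        · exact Or.inl (by rw [hiw])
        · exact Or.inr (by rw [hiw])
      · rintro (rfl | rfl)
        · haveI := (P 0).isPrime
          exact ⟨(P 0).isPrime, (liesOver_span_iff_natCast_mem hℓ _).mpr ((hwv _).mp (hP 0).1)⟩
        · haveI := (P 1).isPrime
          exact ⟨(P 1).isPrime, (liesOver_span_iff_natCast_mem hℓ _).mpr ((hwv _).mp (hP 1).1)⟩
    rw [hset, Set.ncard_pair fun h => h01 (HeightOneSpectrum.ext h)]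
  have hprodS : r x₀ * r x₁ = (ℓ : k') := by
    have hprodC : ψ (P 0) * ψ (P 1) = (ℓ : ℂ) := by
      rw [← Literature.NumberTheory.EllipticCurves.ModularForms.idealPow_span_natGenerator_of_pair hK2 ψ v h01 hSv (hf1' _ (hP 0).1) (hf1' _ (hP 1).1),
        show (Rat.HeightOneSpectrum.natGenerator v : ℕ) = ℓ from hv,
        hneb ℓ (hℓ.odd_of_ne_two hℓ2) hℓcop, hjac]
      push_cast
      ring
    have hxx : x₀ * x₁ = (ℓ : padicCoeffIntegers S) := by
      apply Subtype.ext
      push_cast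
      rw [hx₀, hx₁, ← map_mul, hprodC, map_natCast]
    rw [← map_mul, hxx, map_natCast]
  -- the `χ` side: `y₀ = Φρ̄(σ)`, `y₁ = Φρ̄(cσc⁻¹)`
  have hσU : σ ∈ ((Serre1972.unitGroup k).comap Φ.toMonoidHom).comap (galoisRepTorsion W p) := hKU F
  have hcU : c ∉ ((Serre1972.unitGroup k).comap Φ.toMonoidHom).comap (galoisRepTorsion W p) := hc
  have hσcU : c * σ * c⁻¹ ∈ ((Serre1972.unitGroup k).comap Φ.toMonoidHom).comap (galoisRepTorsion W p) :=
    conj_mem_of_mem W p Φ hGN c hσU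
  set u₀ : (Serre1972.unitGroup k).comap (Φ.toMonoidHom.comp (galoisRepTorsion W p)) := ⟨σ, hKU F⟩ with hu₀
  set u₁ : (Serre1972.unitGroup k).comap (Φ.toMonoidHom.comp (galoisRepTorsion W p)) :=
    ⟨c * σ * c⁻¹, conj_mem_of_mem W p Φ hGN c (hKU F)⟩ with hu₁
  have hk' : adjoinElem y₀ = k := adjoinElem_eq_of_mem_of_finrank_eq_two h2k hy₀ hys
  obtain ⟨a₀, b₀, hab₀⟩ : ∃ a b : ZMod p,
      ((Φ (galoisRepTorsion W p σ) : GL (Fin 2) (ZMod p)) : Matrix (Fin 2) (Fin 2) (ZMod p)) = a • 1 + b • y₀ :=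
    mem_adjoinElem_iff.mp (by rw [hk']; exact hσU)
  obtain ⟨a₁, b₁, hab₁⟩ : ∃ a b : ZMod p,
      ((Φ (galoisRepTorsion W p (c * σ * c⁻¹)) : GL (Fin 2) (ZMod p)) : Matrix (Fin 2) (Fin 2) (ZMod p)) = a • 1 + b • y₀ :=
    mem_adjoinElem_iff.mp (by rw [hk']; exact hσcU)
  have hχ₀ : ((χ u₀ : k'ˣ) : k') = algebraMap (ZMod p) k' a₀ + algebraMap (ZMod p) k' b₀ * lam := hχ u₀ a₀ b₀ hab₀
  have hχ₁ : ((χ u₁ : k'ˣ) : k') = algebraMap (ZMod p) k' a₁ + algebraMap (ZMod p) k' b₁ * lam := hχ u₁ a₁ b₁ hab₁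
  -- sum of the matrices `= a_ℓ • 1`, trace `a_ℓ`, determinant `ℓ`
  have hsumM := frob_add_conj_eq_frobeniusTrace_smul_one_of_mem W p Φ hk htr hGN hℓp hgood hv h𝔓₀ hσF hσU hcU
  have htrM : ((Φ (galoisRepTorsion W p σ) : GL (Fin 2) (ZMod p)) : Matrix (Fin 2) (Fin 2) (ZMod p)).trace =
      ((W.frobeniusTrace ℓ : ℤ) : ZMod p) := by
    letI : Module (ZMod p) (geomTorsion W p) := AddSubgroup.torsionBy.zmodModule
    rw [htr, W.trace_galoisRepTorsion_frobenius_eq p hℓp hgood hv h𝔓₀ hσF]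
  have hdetM := det_frob_eq W p Φ e₀ he₀ hℓp hgood hv h𝔓₀ hσF
  have hprodM : ((Φ (galoisRepTorsion W p σ) : GL (Fin 2) (ZMod p)) : Matrix (Fin 2) (Fin 2) (ZMod p)) *
      ((Φ (galoisRepTorsion W p (c * σ * c⁻¹)) : GL (Fin 2) (ZMod p)) : Matrix (Fin 2) (Fin 2) (ZMod p)) =
        (ℓ : ZMod p) • (1 : Matrix (Fin 2) (Fin 2) (ZMod p)) := by
    have hy₁ : ((Φ (galoisRepTorsion W p (c * σ * c⁻¹)) : GL (Fin 2) (ZMod p)) : Matrix (Fin 2) (Fin 2) (ZMod p)) =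
        ((W.frobeniusTrace ℓ : ℤ) : ZMod p) • (1 : Matrix (Fin 2) (Fin 2) (ZMod p)) -
          ((Φ (galoisRepTorsion W p σ) : GL (Fin 2) (ZMod p)) : Matrix (Fin 2) (Fin 2) (ZMod p)) :=
      eq_sub_of_add_eq' hsumM
    rw [hy₁, mul_sub, mul_smul_comm, mul_one, sq_eq_trace_smul_sub_det_smul, htrM, hdetM]
    abel
  -- `χ(σ) + χ(cσc⁻¹) = a_ℓ`, `χ(σ) χ(cσc⁻¹) = ℓ`
  have hsumχ : ((χ u₀ : k'ˣ) : k') + ((χ u₁ : k'ˣ) : k') = ((W.frobeniusTrace ℓ : ℤ) : k') := by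
    have hM : (a₀ + a₁) • (1 : Matrix (Fin 2) (Fin 2) (ZMod p)) + (b₀ + b₁) • y₀ =
        ((W.frobeniusTrace ℓ : ℤ) : ZMod p) • 1 + (0 : ZMod p) • y₀ := by
      rw [add_smul, add_smul, zero_smul, add_zero, ← hsumM, hab₀, hab₁]; abel
    obtain ⟨ha, hb⟩ := smul_one_add_smul_inj hys hM
    rw [hχ₀, hχ₁, show algebraMap (ZMod p) k' a₀ + algebraMap (ZMod p) k' b₀ * lam +
        (algebraMap (ZMod p) k' a₁ + algebraMap (ZMod p) k' b₁ * lam) =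
        algebraMap (ZMod p) k' (a₀ + a₁) + algebraMap (ZMod p) k' (b₀ + b₁) * lam by rw [map_add, map_add]; ring,
      ha, hb, map_zero, zero_mul, add_zero, map_intCast]
  have hprodχ : ((χ u₀ : k'ˣ) : k') * ((χ u₁ : k'ˣ) : k') = (ℓ : k') := by
    have hmul : ((Φ (galoisRepTorsion W p ((u₀ * u₁ : (Serre1972.unitGroup k).comap
        (Φ.toMonoidHom.comp (galoisRepTorsion W p))) : absoluteGaloisGroup ℚ)) : GL (Fin 2) (ZMod p)) :
          Matrix (Fin 2) (Fin 2) (ZMod p)) = (ℓ : ZMod p) • (1 : Matrix (Fin 2) (Fin 2) (ZMod p)) + (0 : ZMod p) • y₀ := by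
      rw [zero_smul, add_zero, Subgroup.coe_mul, map_mul, map_mul, Units.val_mul]
      exact hprodM
    have h := hχ (u₀ * u₁) (ℓ : ZMod p) 0 hmul
    rw [map_mul, Units.val_mul, map_zero, zero_mul, add_zero, map_natCast] at h
    exact h
  -- conclude: the two root multisets of `X² − a_ℓ X + ℓ` over the field `k'`
  rcases hxF with hxF | hxF <;> rw [hxF]
  · exact eq_or_eq_of_add_eq_of_mul_eq (hsumS.trans hsumχ.symm) (hprodS.trans hprodχ.symm)
  · rw [add_comm] at hsumS
    rw [mul_comm] at hprodS
    exact eq_or_eq_of_add_eq_of_mul_eq (hsumS.trans hsumχ.symm) (hprodS.trans hprodχ.symm)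


end Pointwise

end Summit.BirchSwinnertonDyer.BirchSwinnertonDyer.Theorems.SmallImageRttCharRoad

end
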